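import Summits.ValiantsHypothesis.ValiantsHypothesis.Theorems.DefinabilityGapAffineRung
import HarnessLib

/-!
# DefinabilityGap — the CEILING of the degree ladder: the planted generator IS algebraically dependent (unconditional)

Route `route-ValiantsHypothesis-DefinabilityGap`, item `KIPlantedHitting` (stmt-ValiantsHypothesis-23547). The degree ladder
(`kiPer_hits_affine`, `kiPer_hits_lowDegree`: no annihilator of degree `< m/2`) cannot be climbed to the item itself:
`G_m : ℂ^{q²} → ℂ^{q³}` has MORE coordinates than seed variables, so by transcendence degree
(`trdeg ℂ ℂ[y] = q²`, Mathlib `MvPolynomial.trdeg_of_isDomain` + `AlgebraicIndependent.cardinalMk_le_trdeg`) it is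
algebraically dependent: `exists_annihilator_kiPer` — a NONZERO annihilator exists for every `m`. The item `KIPlantedHitting`
is therefore genuinely about the CIRCUIT SIZE (and polynomial degree `q^b`) of annihilators, the Kabanets–Impagliazzo content;
degree-only rungs live strictly below it. 0 sorry.
-/

noncomputable section

open MvPolynomial Cardinal
open Literature.Computability.AlgebraicComplexity Literature.Computability.MetaComplexity

namespace Summit.ValiantsHypothesis.ValiantsHypothesis.Theorems.DefinabilityGapAffineRung

/-- `q(m) ≥ 2`. [this file] -/
theorem two_le_qOf (m : ℕ) : 2 ≤ qOf m := (qOf_spec m).2.two_le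

/-- There are more coordinates (`q³`) than seed variables (`q²`). [this file] -/
theorem card_seed_lt_card_coord (m : ℕ) :
    Fintype.card (Fin (qOf m) × Fin (qOf m)) < Fintype.card (Fin 3 → Fin (qOf m)) := by
  rw [Fintype.card_prod, Fintype.card_fin, Fintype.card_fun, Fintype.card_fin, Fintype.card_fin]
  have hq := two_le_qOf m
  calc qOf m * qOf m < qOf m * qOf m * qOf m := by
        have hpos : 0 < qOf m * qOf m := Nat.mul_pos (by omega) (by omega)
        nlinarith
    _ = qOf m ^ 3 := by ring

/-- **The planted KI permanent generator is algebraically dependent** (every `m`). [this file] -/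
theorem kiPer_not_algebraicIndependent (m : ℕ) : ¬ AlgebraicIndependent ℂ (kiPer m) := by
  intro h
  have h1 := h.cardinalMk_le_trdeg
  rw [MvPolynomial.trdeg_of_isDomain, Cardinal.mk_fintype, Cardinal.mk_fintype, Cardinal.lift_natCast,
    Nat.cast_le] at h1
  exact absurd h1 (not_le.2 (card_seed_lt_card_coord m))

/-- **Ceiling of the degree ladder**: a NONZERO annihilator of `G_m` exists, for every `m`. [this file] -/
theorem exists_annihilator_kiPer (m : ℕ) :
    ∃ D : MvPolynomial (Fin 3 → Fin (qOf m)) ℂ, D ≠ 0 ∧ bind₁ (kiPer m) D = 0 := by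
  have h := kiPer_not_algebraicIndependent m
  rw [algebraicIndependent_iff] at h
  push Not at h
  obtain ⟨D, hD0, hD⟩ := h
  refine ⟨D, hD, ?_⟩
  rwa [aeval_eq_bind₁] at hD0

/-- … and any annihilator has degree `≥ m/2` (the low-degree rung read contrapositively is in
`DefinabilityGapLowDegreeRung`); here the affine case: an annihilator is not affine-linear once `m ≥ 3`. [this file] -/
theorem two_le_totalDegree_of_annihilator {m : ℕ} (hm : 3 ≤ m) {D : MvPolynomial (Fin 3 → Fin (qOf m)) ℂ}
    (hD : D ≠ 0) (hann : bind₁ (kiPer m) D = 0) : 2 ≤ D.totalDegree := by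
  by_contra hlt
  exact kiPer_hits_affine hm D hD (by omega) hann

end Summit.ValiantsHypothesis.ValiantsHypothesis.Theorems.DefinabilityGapAffineRung

end
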